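import Summits.QuantumFields.YangMills.Theorems.LuscherReductionTwistedTraceScalingBOStiffTailCurrency
import Summits.QuantumFields.YangMills.Theorems.LuscherReductionTwistedTraceScalingBODualProfile
import Summits.QuantumFields.YangMills.Theorems.LuscherReductionTwistedTraceScalingBODefectShellRate
import HarnessLib

/-!
# (B-ST) step (B)/(S8.5), the ν-TAIL OF THE RECORD PROFILE off the core is an arbitrarily small multiple of the fibre-mass constant `γ`, eventually in `β`
# (lane A of S-BASE, crux `TwistedTraceScaling` stmt-QuantumFields-20203, C4-CORE, the (B-ST) pen; design card `pub/ym-fleet/ym-luscher-20007-p1/Lines-BST-poincare.md` (B); HANDOFF-g21 (S8) step 5)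

The almost-orthogonality inequality `…BOStiffAlmostOrth.sq_integral_core_profile_le` prices the core piece's ground coefficient by the profile mass OFF the core,
`∫ (𝟙_{Sᶜ}Θ)²·w_u dπ`, `Θ(v) = Ω_c(v̂)` (`v̂ = linkEmbed v`, `Ω_c` the cap-restricted frozen stiff-Gaussian profile of record), `w_u(v) = softWeight χ (orthoTube u v)`,
`χ = recordChi L s 43 M β`, `S = {‖v̂‖ ≤ r_f/2} ∩ {‖P_Γv̂‖ ≤ β^{-1}ℓ}` (inner fibre ball ∩ gauge-near; `r_f = min(1/40, β^{-1/2}ℓ)`, `ℓ = btLog β`).  This file: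
* ★ `recordProfile_sq_mul_softWeight_eq` — EXACTLY `Ω_c(v̂)²·w_u = 𝟙{‖v̂‖ ≤ r_f}·((e^{−q(v̂)})²·e^{−‖P_Γv̂‖²/β^{-2}})·(𝟙_F·N)(orthoTube u v)` (dual profile identity `…BODualProfile`; off the
  fat tube `F` both sides vanish), `N = gaugeAvg χ`;
* ★ `core_compl_integrand_le` — off `S` the Gaussian-stiff integrand is `≤ e^{−β·gap·R²} + e^{−τ²/β^{-2}}` (shell: `…BOMassRatio.shell_integrand_le_of_hodge` with the landed Hodge lemma
  `…VacuumHodge.ker_covCurl_one_le`; gauge-far: the Gaussian), `gap = 2 − 2cos(2π/L)`;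
* ★★ `eventually_fibre_tail_le` — `∃ M₀ ≥ 2, ∀ M ≥ M₀, ∀ᶠ β, ∀ u`: `∫ (𝟙_{Sᶜ}Θ)²w_u dπ ≤ N̄(β^{-1})·2(e^{−(gap/4)ℓ²} + e^{−ℓ²})·π(univ)` ((P) `…FPWeightCore.fpWeight_core_constant`:
  `N ≤ 2N̄` on the fat tube; `β·r_f² = ℓ²` by `…BODefectPieceRates.eventually_beta_mul_rf_sq`);
* ★★★ `eventually_fibre_tail_le_mul_recordGamma` — `… ≤ a·γ(β)` for EVERY `a > 0` (`γ = recordGamma L Ω_c β = N̄·M₂` by `…BORecordGamma.recordGamma_eq`, `M₂ ≥ M₂^{in} ≥ e^{−99}c_b(β^{-1})^{6|E|}`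
  by `…BODefectShellRate.inner_mass_poly_floor`, and `e^{−(gap/4)ℓ²}` beats every power).  With `Z_u ∈ (1±κ)γ` (`…FibreMassBrick.fibreMass_brick_record`) this is the `C ≤ o(1)·N`
  input of `…BOStiffSlowAssembly.form_le_of_product_near`.
HONEST FRAMING: bookkeeping for a stub of a child of the CONDITIONAL route R2b1; (B-ST) OPEN; C4-CORE OPEN; not infinite volume, not a gap, not Clay.
-/

set_option autoImplicit false

noncomputable section

open MeasureTheory Filter Topology Real
open scoped BigOperators

namespace Summit.QuantumFields.YangMills.Theorems.FemtoTransferGap.TwoLattice.ConstTube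

open Literature.MathematicalPhysics.QuantumFieldTheory
open Literature.MathematicalPhysics.QuantumLattice
open Summit.QuantumFields.YangMills.Theorems.FemtoTransferGap
open Summit.QuantumFields.YangMills.Theorems.FemtoTransferGap.TwoLattice
open Summit.QuantumFields.YangMills.Theorems.FemtoTransferGap.TwoLattice.Avg
open Summit.QuantumFields.YangMills.Theorems.FemtoTransferGap.TwoLattice.Stiff
open Summit.QuantumFields.YangMills.Theorems.FemtoTransferGap.TwoLattice.GnChart
open Summit.QuantumFields.YangMills.Theorems.FemtoTransferGap.TwoLattice.Cov
open Summit.QuantumFields.YangMills.Theorems.FemtoTransferGap.TwoLattice.Toron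

variable {L : ℕ} [NeZero L]

/-- ★ **The fibre integrand of record, exactly**: at `U = orthoTube u v` (`v` in the cap), with `χ = recordChi L s K M β`, `F` its fat tube, `N = gaugeAvg χ`,
`Ω_c(v̂)²·softWeight χ U = 𝟙{‖v̂‖ ≤ r_f}·((e^{−q(v̂)})²·e^{−‖P_Γv̂‖²/β^{-2}})·(𝟙_F·N)(U)` (`v̂ = linkEmbed v`; off `F` both sides vanish). [cite: Luscher1983, §3] -/
theorem recordProfile_sq_mul_softWeight_eq (s K M β : ℝ) (u : GaugeConfig 3 1 SU2) {v : Edge 3 L → Fin 3 → ℝ} (hv : v ∈ capBalancedSet L) :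
    ({x : LinkSpace L | linkCurry x ∈ capBalancedSet L}.indicator (fun _ => (1 : ℝ)) (linkEmbed L v) *
        frozenProfile L (fun β' => stiffGaussExp L (β' / 2) β') (fun β' => min (1 / 40) (powScale (1 / 2) β' * btLog β')) β (linkEmbed L v)) ^ 2 *
      softWeight (recordChi L s K M β) (orthoTube L u v) =
    {v : Edge 3 L → Fin 3 → ℝ | ‖linkEmbed L v‖ ≤ min (1 / 40) (powScale (1 / 2) β * btLog β)}.indicator (fun _ => (1 : ℝ)) v *
      (Real.exp (-(stiffGaussExp L (β / 2) β (linkEmbed L v))) ^ 2 * Real.exp (-(‖(gaugeModes L).starProjection (linkEmbed L v)‖ ^ 2 / powScale 1 β ^ 2))) *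
      (fatTubeRho L (fun β => K * powScale s β) (fun b => M * (K * powScale s b)) β).indicator (gaugeAvg (recordChi L s K M β)) (orthoTube L u v) := by
  set F := fatTubeRho L (fun β => K * powScale s β) (fun b => M * (K * powScale s b)) β with hFdef
  rw [Set.indicator_of_mem ((linkEmbed_mem_capLink_iff v).2 hv), one_mul]
  have hball : (Metric.closedBall (0 : LinkSpace L) (min (1 / 40) (powScale (1 / 2) β * btLog β))).indicator (fun _ => (1 : ℝ)) (linkEmbed L v) =
      {v : Edge 3 L → Fin 3 → ℝ | ‖linkEmbed L v‖ ≤ min (1 / 40) (powScale (1 / 2) β * btLog β)}.indicator (fun _ => (1 : ℝ)) v := by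
    by_cases h : ‖linkEmbed L v‖ ≤ min (1 / 40) (powScale (1 / 2) β * btLog β)
    · rw [Set.indicator_of_mem (by simpa [Metric.mem_closedBall, dist_zero_right] using h), Set.indicator_of_mem (by exact h)]
    · rw [Set.indicator_of_notMem (by simpa [Metric.mem_closedBall, dist_zero_right] using h), Set.indicator_of_notMem (by exact h)]
  by_cases hU : orthoTube L u v ∈ F
  · rw [frozenProfile_sq_mul_softWeight_orthoTube (fun U => recordChi_eq_indicator_mul s K M β U) _ _ u hv hU, Set.indicator_of_mem hU, hball]
    have e2 : Real.exp (-(2 * stiffGaussExp L (β / 2) β (linkEmbed L v))) = Real.exp (-(stiffGaussExp L (β / 2) β (linkEmbed L v))) ^ 2 := by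
      rw [← Real.exp_nat_mul]; congr 1; push_cast; ring
    rw [e2]; ring
  · have hχ0 : recordChi L s K M β (orthoTube L u v) = 0 := by
      rw [recordChi_eq_indicator_mul, Set.indicator_of_notMem hU, zero_mul]
    rw [Set.indicator_of_notMem hU, softWeight_eq_div, hχ0, div_zero, mul_zero, mul_zero]

/-- `gap(L) = 2 − 2cos(2π/L) ≤ 4`. [folklore] -/
theorem gap_le_four (L : ℕ) : 2 - 2 * Real.cos (2 * Real.pi / L) ≤ 4 := by
  have := Real.neg_one_le_cos (2 * Real.pi / L); linarith

/-- ★ **Off the core the integrand is super-polynomially small**: for balanced `v`, `β ≥ max(1, gap)`, `R, τ ≥ 0` and `v ∉ S = {‖v̂‖ ≤ R} ∩ {‖P_Γv̂‖ ≤ τ}`,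
`(e^{−q_{β/2,β}(v̂)})²·e^{−‖P_Γv̂‖²/β^{-2}} ≤ e^{−β·gap·R²} + e^{−τ²/β^{-2}}` (shell: `…BOMassRatio.shell_integrand_le_of_hodge` with `…VacuumHodge.ker_covCurl_one_le`; far: the Gaussian). [cite: Luscher1983, §3] -/
theorem core_compl_integrand_le (hL : 2 ≤ L) {β : ℝ} (hβ1 : 1 ≤ β) (hβg : 2 - 2 * Real.cos (2 * Real.pi / L) ≤ β) {v : Edge 3 L → Fin 3 → ℝ} (hv : v ∈ balancedSet L)
    {R τ : ℝ} (hR : 0 ≤ R) (hτ : 0 ≤ τ) :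
    {v : Edge 3 L → Fin 3 → ℝ | ‖linkEmbed L v‖ ≤ R ∧ ‖(gaugeModes L).starProjection (linkEmbed L v)‖ ≤ τ}ᶜ.indicator (fun _ => (1 : ℝ)) v *
        (Real.exp (-(stiffGaussExp L (β / 2) β (linkEmbed L v))) ^ 2 * Real.exp (-(‖(gaugeModes L).starProjection (linkEmbed L v)‖ ^ 2 / powScale 1 β ^ 2))) ≤
      Real.exp (-(β * (2 - 2 * Real.cos (2 * Real.pi / L)) * R ^ 2)) + Real.exp (-(τ ^ 2 / powScale 1 β ^ 2)) := by
  have hA0 : 0 ≤ Real.exp (-(β * (2 - 2 * Real.cos (2 * Real.pi / L)) * R ^ 2)) := (Real.exp_pos _).le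
  have hB0 : 0 ≤ Real.exp (-(τ ^ 2 / powScale 1 β ^ 2)) := (Real.exp_pos _).le
  have hI0 : 0 ≤ Real.exp (-(stiffGaussExp L (β / 2) β (linkEmbed L v))) ^ 2 * Real.exp (-(‖(gaugeModes L).starProjection (linkEmbed L v)‖ ^ 2 / powScale 1 β ^ 2)) := by positivity
  by_cases hS : v ∈ {v : Edge 3 L → Fin 3 → ℝ | ‖linkEmbed L v‖ ≤ R ∧ ‖(gaugeModes L).starProjection (linkEmbed L v)‖ ≤ τ}ᶜ
  · rw [Set.indicator_of_mem hS, one_mul]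
    rw [Set.mem_compl_iff, Set.mem_setOf_eq, not_and_or, not_le, not_le] at hS
    rcases hS with hRlt | hτlt
    · exact (shell_integrand_le_of_hodge (L := L) hL ker_covCurl_one_le hβ1 hβg hv hR hRlt).trans (le_add_of_nonneg_right hB0)
    · have h1 : Real.exp (-(stiffGaussExp L (β / 2) β (linkEmbed L v))) ^ 2 ≤ 1 :=
        pow_le_one₀ (Real.exp_pos _).le (Real.exp_le_one_iff.mpr (neg_nonpos.mpr (stiffGaussExp_nonneg _ _ _)))
      have h2 : Real.exp (-(‖(gaugeModes L).starProjection (linkEmbed L v)‖ ^ 2 / powScale 1 β ^ 2)) ≤ Real.exp (-(τ ^ 2 / powScale 1 β ^ 2)) := by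
        rw [Real.exp_le_exp, neg_le_neg_iff]
        exact div_le_div_of_nonneg_right (pow_le_pow_left₀ hτ hτlt.le 2) (sq_nonneg _)
      calc _ ≤ 1 * Real.exp (-(τ ^ 2 / powScale 1 β ^ 2)) := mul_le_mul h1 h2 (Real.exp_pos _).le zero_le_one
        _ = _ := one_mul _
        _ ≤ _ := le_add_of_nonneg_left hA0
  · rw [Set.indicator_of_notMem hS, zero_mul]; exact add_nonneg hA0 hB0

/-- `P·e^{−q·ℓ²} ≤ c·(β^{-1})^m` eventually (`q, c > 0`, `P ≥ 0`, `ℓ = btLog β`): super-polynomial beats polynomial. [folklore] -/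
theorem eventually_exp_neg_btLog_sq_le {q P c : ℝ} (hq : 0 < q) (hP : 0 ≤ P) (hc : 0 < c) (m : ℕ) :
    ∀ᶠ β : ℝ in atTop, P * Real.exp (-(q * btLog β ^ 2)) ≤ c * powScale 1 β ^ m := by
  filter_upwards [eventually_exp_logsq_le (K := Real.log (P + 1)) hq hc m, eventually_ge_atTop (1 : ℝ)] with β hsm hβ1
  have hP1 : P ≤ Real.exp (Real.log (P + 1)) := by rw [Real.exp_log (by linarith)]; linarith
  calc P * Real.exp (-(q * btLog β ^ 2)) ≤ Real.exp (Real.log (P + 1)) * Real.exp (-(q * Real.log β ^ 2)) :=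
        mul_le_mul hP1 (exp_neg_btLog_sq_le hq.le hβ1) (Real.exp_pos _).le (Real.exp_pos _).le
    _ = Real.exp (Real.log (P + 1) - q * Real.log β ^ 2) := by rw [← Real.exp_add]; ring_nf
    _ ≤ c * powScale 1 β ^ m := hsm

set_option maxHeartbeats 800000 in
-- long record expressions.
/-- ★★ **THE ν-TAIL OF THE RECORD PROFILE OFF THE CORE OF RECORD, eventually in `β`** (`L ≥ 2` with a non-zero site, `0 < s ≤ 1/3`): there is `M₀ ≥ 2` such that for every `M ≥ M₀`,
eventually in `β`, for EVERY slow `u`, with `S = {‖v̂‖ ≤ r_f/2} ∩ {‖P_Γv̂‖ ≤ β^{-1}ℓ}`, `Θ(v) = Ω_c(v̂)`, `w_u(v) = softWeight (recordChi L s 43 M β) (orthoTube u v)`: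
`∫ (𝟙_{Sᶜ}Θ)²·w_u dπ ≤ N̄(β^{-1})·(2·(e^{−(gap/4)ℓ²} + e^{−ℓ²}))·π(univ)` ((P) `fpWeight_core_constant`: `N ≤ 2N̄` on the fat tube). [cite: Luscher1983, §3] -/
theorem eventually_fibre_tail_le (hLz : Nonempty (NzSite L)) (hL : 2 ≤ L) {s : ℝ} (hs : 0 < s) (hs3 : s ≤ 1 / 3) :
    ∃ M₀ : ℝ, 2 ≤ M₀ ∧ ∀ M : ℝ, M₀ ≤ M → ∀ᶠ β : ℝ in atTop, ∀ u : GaugeConfig 3 1 SU2,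
      ∫ v, ({v : Edge 3 L → Fin 3 → ℝ | ‖linkEmbed L v‖ ≤ min (1 / 40) (powScale (1 / 2) β * btLog β) / 2 ∧
              ‖(gaugeModes L).starProjection (linkEmbed L v)‖ ≤ powScale 1 β * btLog β}ᶜ.indicator
            (fun v => {x : LinkSpace L | linkCurry x ∈ capBalancedSet L}.indicator (fun _ => (1 : ℝ)) (linkEmbed L v) *
              frozenProfile L (fun β' => stiffGaussExp L (β' / 2) β') (fun β' => min (1 / 40) (powScale (1 / 2) β' * btLog β')) β (linkEmbed L v)) v) ^ 2 *
          softWeight (recordChi L s 43 M β) (orthoTube L u v) ∂orthoTransverse L ≤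
        fpWeightBar L (powScale 1 β) * (2 * (Real.exp (-((2 - 2 * Real.cos (2 * Real.pi / L)) / 4 * btLog β ^ 2)) + Real.exp (-(btLog β ^ 2)))) *
          (orthoTransverse L).real Set.univ := by
  haveI := isFiniteMeasure_orthoTransverse L
  have hδ0 : ∀ β, 0 < 43 * powScale s β := fun β => mul_pos (by norm_num) (powScale_pos s β)
  have hδ : Tendsto (fun β => 43 * powScale s β) atTop (𝓝 0) := by simpa using (tendsto_powScale hs).const_mul 43
  have hsd1 : ∀ᶠ β in atTop, 0 < powScale 1 β ∧ powScale 1 β ≤ (43 * powScale s β) ^ 3 := by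
    filter_upwards [eventually_ge_atTop (1 : ℝ)] with β hβ
    have hp := powScale_pos 1 β
    have h1 : powScale 1 β ≤ powScale s β ^ 3 := powScale_one_le_cube hs3 hβ
    have hps0 : 0 ≤ powScale s β ^ 3 := pow_nonneg (powScale_pos s β).le 3
    refine ⟨hp, h1.trans ?_⟩
    calc powScale s β ^ 3 = 1 * powScale s β ^ 3 := (one_mul _).symm
      _ ≤ 43 ^ 3 * powScale s β ^ 3 := mul_le_mul_of_nonneg_right (by norm_num) hps0
      _ = (43 * powScale s β) ^ 3 := by ring
  obtain ⟨M₀, hM₀, H⟩ := fpWeight_core_constant L hLz hδ0 hδ hsd1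
  refine ⟨M₀, hM₀, fun M hM => ?_⟩
  obtain ⟨C, β₀, hC, hP⟩ := H M hM
  have hδ2 : Tendsto (fun β => (43 * powScale s β) ^ 2) atTop (𝓝 0) := by simpa using hδ.pow 2
  filter_upwards [eventually_ge_atTop β₀, eventually_ge_atTop (1 : ℝ), eventually_ge_atTop (4 : ℝ), eventually_mul_le_of_tendsto hδ2 C one_pos,
    eventually_beta_mul_rf_sq] with β hβ0 hβ1 hβ4 hCδ hrf u
  set gap : ℝ := 2 - 2 * Real.cos (2 * Real.pi / L) with hgapdef
  have hβg : gap ≤ β := (gap_le_four L).trans hβ4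
  set rf : ℝ := min (1 / 40) (powScale (1 / 2) β * btLog β) with hrfdef
  set τ : ℝ := powScale 1 β * btLog β with hτdef
  set Nbar := fpWeightBar L (powScale 1 β) with hNbar
  have hNbar0 : 0 < Nbar := fpWeightBar_pos L (powScale_pos 1 β)
  have hrf0 : 0 ≤ rf / 2 := by
    have : 0 < rf := lt_min (by norm_num) (mul_pos (powScale_pos _ _) (lt_of_lt_of_le one_pos (one_le_btLog β)))
    linarith
  have hτ0 : 0 ≤ τ := mul_nonneg (powScale_pos 1 β).le (zero_le_one.trans (one_le_btLog β))
  -- the two exponents of record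
  have hexp1 : Real.exp (-(β * gap * (rf / 2) ^ 2)) = Real.exp (-(gap / 4 * btLog β ^ 2)) := by
    congr 1; rw [div_pow, show β * gap * (rf ^ 2 / 2 ^ 2) = gap / 4 * (β * rf ^ 2) by ring, hrf]
  have hexp2 : Real.exp (-(τ ^ 2 / powScale 1 β ^ 2)) = Real.exp (-(btLog β ^ 2)) := by
    congr 1; rw [hτdef, mul_pow]; field_simp [(powScale_pos 1 β).ne']
  set ε : ℝ := Real.exp (-(gap / 4 * btLog β ^ 2)) + Real.exp (-(btLog β ^ 2)) with hεdef
  have hε0 : 0 ≤ ε := add_nonneg (Real.exp_pos _).le (Real.exp_pos _).le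
  -- pointwise bound of the integrand by the constant `N̄·2ε`
  set S : Set (Edge 3 L → Fin 3 → ℝ) := {v | ‖linkEmbed L v‖ ≤ rf / 2 ∧ ‖(gaugeModes L).starProjection (linkEmbed L v)‖ ≤ τ} with hSdef
  set F := fatTubeRho L (fun β => 43 * powScale s β) (fun b => M * (43 * powScale s b)) β with hFdef
  have hw0 : ∀ U, 0 ≤ softWeight (recordChi L s 43 M β) U := (softWeight_recordChi_props (L := L) s 43 M β).2.2.1
  have hpt : ∀ v : Edge 3 L → Fin 3 → ℝ,
      (Sᶜ.indicator (fun v => {x : LinkSpace L | linkCurry x ∈ capBalancedSet L}.indicator (fun _ => (1 : ℝ)) (linkEmbed L v) *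
            frozenProfile L (fun β' => stiffGaussExp L (β' / 2) β') (fun β' => min (1 / 40) (powScale (1 / 2) β' * btLog β')) β (linkEmbed L v)) v) ^ 2 *
          softWeight (recordChi L s 43 M β) (orthoTube L u v) ≤ Nbar * (2 * ε) := by
    intro v
    have hK0 : 0 ≤ Nbar * (2 * ε) := by positivity
    by_cases hvS : v ∈ Sᶜ
    swap
    · rw [Set.indicator_of_notMem hvS]; simpa using hK0
    rw [Set.indicator_of_mem hvS]
    by_cases hv : v ∈ capBalancedSet L
    swap
    · have h0 : {x : LinkSpace L | linkCurry x ∈ capBalancedSet L}.indicator (fun _ => (1 : ℝ)) (linkEmbed L v) = 0 :=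
        Set.indicator_of_notMem (fun h => hv ((linkEmbed_mem_capLink_iff v).1 h)) _
      rw [h0, zero_mul]; simpa using hK0
    rw [recordProfile_sq_mul_softWeight_eq s 43 M β u hv]
    -- the `F`-indicator of `N` is `≤ N̄(1 + Cδ²) ≤ 2N̄`
    have hN : F.indicator (gaugeAvg (recordChi L s 43 M β)) (orthoTube L u v) ≤ Nbar * 2 := by
      by_cases hU : orthoTube L u v ∈ F
      · rw [Set.indicator_of_mem hU]
        have h := (hP β hβ0 _ hU).2
        have : Nbar * (1 + C * (43 * powScale s β) ^ 2) ≤ Nbar * 2 := mul_le_mul_of_nonneg_left (by linarith) hNbar0.le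
        exact h.trans this
      · rw [Set.indicator_of_notMem hU]; positivity
    have hN0 : 0 ≤ F.indicator (gaugeAvg (recordChi L s 43 M β)) (orthoTube L u v) := by
      by_cases hU : orthoTube L u v ∈ F
      · rw [Set.indicator_of_mem hU]
        obtain ⟨hm, h1, h0, -⟩ := recordChi_props (L := L) s 43 M β
        exact (gaugeAvg_mem_Icc hm (fun V => h0 V) (fun V => (abs_le.mp (h1 V)).2) _).1
      · rw [Set.indicator_of_notMem hU]
    -- the ball indicator is `≤ 1`, the Gaussian-stiff integrand off `S` is `≤ ε`
    have hball1 : {v : Edge 3 L → Fin 3 → ℝ | ‖linkEmbed L v‖ ≤ min (1 / 40) (powScale (1 / 2) β * btLog β)}.indicator (fun _ => (1 : ℝ)) v ≤ 1 :=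
      Set.indicator_le_self' (fun _ _ => zero_le_one) v
    have hball0 : 0 ≤ {v : Edge 3 L → Fin 3 → ℝ | ‖linkEmbed L v‖ ≤ min (1 / 40) (powScale (1 / 2) β * btLog β)}.indicator (fun _ => (1 : ℝ)) v :=
      Set.indicator_nonneg (fun _ _ => zero_le_one) v
    have hint := core_compl_integrand_le (L := L) hL hβ1 hβg hv.1 hrf0 hτ0
    rw [Set.indicator_of_mem hvS, one_mul, hexp1, hexp2] at hint
    have hI0 : 0 ≤ Real.exp (-(stiffGaussExp L (β / 2) β (linkEmbed L v))) ^ 2 * Real.exp (-(‖(gaugeModes L).starProjection (linkEmbed L v)‖ ^ 2 / powScale 1 β ^ 2)) := by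
      positivity
    calc _ ≤ 1 * ε * (Nbar * 2) := mul_le_mul (mul_le_mul hball1 hint hI0 zero_le_one) hN hN0 (by positivity)
      _ = Nbar * (2 * ε) := by ring
  calc _ ≤ ∫ _v, Nbar * (2 * ε) ∂orthoTransverse L :=
        integral_mono_of_nonneg (ae_of_all _ fun v => mul_nonneg (sq_nonneg _) (hw0 _)) (integrable_const _) (ae_of_all _ hpt)
    _ = fpWeightBar L (powScale 1 β) * (2 * ε) * (orthoTransverse L).real Set.univ := by
        rw [integral_const, smul_eq_mul, hNbar]; ring

/-- `v ↦ linkEmbed v` is measurable; the Gaussian-stiff integrand of record is measurable in `v`. [folklore] -/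
theorem measurable_record_integrand (β : ℝ) :
    Measurable fun v : Edge 3 L → Fin 3 → ℝ =>
      Real.exp (-(stiffGaussExp L (β / 2) β (linkEmbed L v))) ^ 2 * Real.exp (-(‖(gaugeModes L).starProjection (linkEmbed L v)‖ ^ 2 / powScale 1 β ^ 2)) := by
  have hl : Continuous fun v : Edge 3 L → Fin 3 → ℝ => linkEmbed L v := (linkEmbed L).continuous_of_finiteDimensional
  have h1 : Continuous fun v : Edge 3 L → Fin 3 → ℝ => Real.exp (-(stiffGaussExp L (β / 2) β (linkEmbed L v))) ^ 2 :=
    (Real.continuous_exp.comp ((continuous_stiffGaussExp _ _).comp hl).neg).pow 2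
  have h2 : Continuous fun v : Edge 3 L → Fin 3 → ℝ => Real.exp (-(‖(gaugeModes L).starProjection (linkEmbed L v)‖ ^ 2 / powScale 1 β ^ 2)) :=
    Real.continuous_exp.comp ((((gaugeModes L).starProjection.continuous.comp hl).norm.pow 2).div_const _).neg
  exact (h1.mul h2).measurable

set_option maxHeartbeats 800000 in
-- long record expressions.
/-- ★★★ **THE ν-TAIL IS AN ARBITRARILY SMALL MULTIPLE OF THE FIBRE-MASS CONSTANT**: with `M₀` as above, for every `M ≥ M₀` and EVERY `a > 0`, eventually in `β`, for every slow `u`,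
`∫ (𝟙_{Sᶜ}Θ)²·w_u dπ ≤ a·γ(β)`, `γ = recordGamma L Ω_c β = N̄·M₂` (`…BORecordGamma.recordGamma_eq`, `M₂ ≥ M₂^{in} ≥ e^{−99}c_b(β^{-1})^{6|E|}` by
`…BODefectShellRate.inner_mass_poly_floor`).  With `Z_u ∈ (1±κ)γ` (`…FibreMassBrick.fibreMass_brick_record`) and §1 this is the `C ≤ o(1)·N` input of `form_le_of_product_near`. [cite: Luscher1983, §3] -/
theorem eventually_fibre_tail_le_mul_recordGamma (hLz : Nonempty (NzSite L)) (hL : 2 ≤ L) {s : ℝ} (hs : 0 < s) (hs3 : s ≤ 1 / 3) :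
    ∃ M₀ : ℝ, 2 ≤ M₀ ∧ ∀ M : ℝ, M₀ ≤ M → ∀ a : ℝ, 0 < a → ∀ᶠ β : ℝ in atTop, ∀ u : GaugeConfig 3 1 SU2,
      ∫ v, ({v : Edge 3 L → Fin 3 → ℝ | ‖linkEmbed L v‖ ≤ min (1 / 40) (powScale (1 / 2) β * btLog β) / 2 ∧
              ‖(gaugeModes L).starProjection (linkEmbed L v)‖ ≤ powScale 1 β * btLog β}ᶜ.indicator
            (fun v => {x : LinkSpace L | linkCurry x ∈ capBalancedSet L}.indicator (fun _ => (1 : ℝ)) (linkEmbed L v) *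
              frozenProfile L (fun β' => stiffGaussExp L (β' / 2) β') (fun β' => min (1 / 40) (powScale (1 / 2) β' * btLog β')) β (linkEmbed L v)) v) ^ 2 *
          softWeight (recordChi L s 43 M β) (orthoTube L u v) ∂orthoTransverse L ≤
        a * recordGamma L (fun β' => fun x : LinkSpace L => {x : LinkSpace L | linkCurry x ∈ capBalancedSet L}.indicator (fun _ => (1 : ℝ)) x *
          frozenProfile L (fun β'' => stiffGaussExp L (β'' / 2) β'') (fun β'' => min (1 / 40) (powScale (1 / 2) β'' * btLog β'')) β' x) β := by
  haveI := isFiniteMeasure_orthoTransverse L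
  obtain ⟨M₀, hM₀, H⟩ := eventually_fibre_tail_le (L := L) hLz hL hs hs3
  refine ⟨M₀, hM₀, fun M hM a ha => ?_⟩
  have hgap : 0 < 2 - 2 * Real.cos (2 * Real.pi / L) := gap_pos L hL
  set cb : ℝ := Real.exp (-99) * ((1 / (20 * Fintype.card (Edge 3 L))) ^ 3 / 10) ^ Fintype.card (Edge 3 L) with hcbdef
  have hE : (0 : ℝ) < Fintype.card (Edge 3 L) := by exact_mod_cast Fintype.card_pos
  have hcb : 0 < cb := by rw [hcbdef]; positivity
  -- budget: `4·e^{−(gap/4)ℓ²}·π(univ) ≤ a·c_b·(β^{-1})^{6|E|}` eventually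
  have hbud := eventually_exp_neg_btLog_sq_le (q := (2 - 2 * Real.cos (2 * Real.pi / L)) / 4) (P := 4 * (orthoTransverse L).real Set.univ) (by positivity)
    (by positivity) (mul_pos ha hcb) (6 * Fintype.card (Edge 3 L))
  filter_upwards [H M hM, hbud, inner_mass_poly_floor (L := L)] with β htail hb hfloor u
  refine (htail u).trans ?_
  set Nbar := fpWeightBar L (powScale 1 β) with hNbar
  have hNbar0 : 0 < Nbar := fpWeightBar_pos L (powScale_pos 1 β)
  set ℓ2 := btLog β ^ 2
  -- `e^{−ℓ²} ≤ e^{−(gap/4)ℓ²}` since `gap ≤ 4`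
  have hcmp : Real.exp (-(btLog β ^ 2)) ≤ Real.exp (-((2 - 2 * Real.cos (2 * Real.pi / L)) / 4 * btLog β ^ 2)) := by
    rw [Real.exp_le_exp, neg_le_neg_iff]
    have h4 := gap_le_four L
    have hl : 0 ≤ btLog β ^ 2 := sq_nonneg _
    nlinarith
  -- the reference mass from below: `γ = N̄·M₂ ≥ N̄·M₂^{in} ≥ N̄·floor`
  set I : (Edge 3 L → Fin 3 → ℝ) → ℝ := fun v =>
    Real.exp (-(stiffGaussExp L (β / 2) β (linkEmbed L v))) ^ 2 * Real.exp (-(‖(gaugeModes L).starProjection (linkEmbed L v)‖ ^ 2 / powScale 1 β ^ 2)) with hIdef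
  have hIm : Measurable I := measurable_record_integrand (L := L) β
  have hI01 : ∀ v, 0 ≤ I v ∧ I v ≤ 1 := fun v => by
    refine ⟨by rw [hIdef]; positivity, ?_⟩
    have h1 : Real.exp (-(stiffGaussExp L (β / 2) β (linkEmbed L v))) ^ 2 ≤ 1 :=
      pow_le_one₀ (Real.exp_pos _).le (Real.exp_le_one_iff.mpr (neg_nonpos.mpr (stiffGaussExp_nonneg _ _ _)))
    have h2 : Real.exp (-(‖(gaugeModes L).starProjection (linkEmbed L v)‖ ^ 2 / powScale 1 β ^ 2)) ≤ 1 :=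
      Real.exp_le_one_iff.mpr (neg_nonpos.mpr (by positivity))
    calc I v ≤ 1 * 1 := mul_le_mul h1 h2 (Real.exp_pos _).le zero_le_one
      _ = 1 := one_mul _
  have hl : Continuous fun v : Edge 3 L → Fin 3 → ℝ => linkEmbed L v := (linkEmbed L).continuous_of_finiteDimensional
  have hmeasBall : ∀ c : ℝ, MeasurableSet {v : Edge 3 L → Fin 3 → ℝ | ‖linkEmbed L v‖ ≤ c} := fun c =>
    measurableSet_le hl.norm.measurable measurable_const
  have hmono : ∫ v, {v : Edge 3 L → Fin 3 → ℝ | ‖linkEmbed L v‖ ≤ min (1 / 40) (powScale (1 / 2) β * btLog β) / 12}.indicator (fun _ => (1 : ℝ)) v * I v ∂orthoTransverse L ≤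
      ∫ v, {v : Edge 3 L → Fin 3 → ℝ | ‖linkEmbed L v‖ ≤ min (1 / 40) (powScale (1 / 2) β * btLog β)}.indicator (fun _ => (1 : ℝ)) v * I v ∂orthoTransverse L := by
    refine integral_mono_of_nonneg (ae_of_all _ fun v => mul_nonneg (Set.indicator_nonneg (fun _ _ => zero_le_one) v) (hI01 v).1) ?_ (ae_of_all _ fun v => ?_)
    · exact integrable_of_measurable_abs_le _ ((measurable_const.indicator (hmeasBall _)).mul hIm) (C := 1) fun v => by
        rw [abs_mul, abs_of_nonneg (Set.indicator_nonneg (fun _ _ => zero_le_one) v), abs_of_nonneg (hI01 v).1]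
        exact mul_le_one₀ (Set.indicator_le_self' (fun _ _ => zero_le_one) v) (hI01 v).1 (hI01 v).2
    · refine mul_le_mul_of_nonneg_right ?_ (hI01 v).1
      by_cases h : v ∈ {v : Edge 3 L → Fin 3 → ℝ | ‖linkEmbed L v‖ ≤ min (1 / 40) (powScale (1 / 2) β * btLog β) / 12}
      · have h' : v ∈ {v : Edge 3 L → Fin 3 → ℝ | ‖linkEmbed L v‖ ≤ min (1 / 40) (powScale (1 / 2) β * btLog β)} := by
          simp only [Set.mem_setOf_eq] at h ⊢
          have : 0 ≤ min (1 / 40) (powScale (1 / 2) β * btLog β) :=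
            le_min (by norm_num) (mul_nonneg (powScale_pos _ _).le (zero_le_one.trans (one_le_btLog β)))
          linarith
        rw [Set.indicator_of_mem h, Set.indicator_of_mem h']
      · rw [Set.indicator_of_notMem h]; exact Set.indicator_nonneg (fun _ _ => zero_le_one) v
  have hγ : Nbar * (cb * powScale 1 β ^ (6 * Fintype.card (Edge 3 L))) ≤
      recordGamma L (fun β' => fun x : LinkSpace L => {x : LinkSpace L | linkCurry x ∈ capBalancedSet L}.indicator (fun _ => (1 : ℝ)) x *
        frozenProfile L (fun β'' => stiffGaussExp L (β'' / 2) β'') (fun β'' => min (1 / 40) (powScale (1 / 2) β'' * btLog β'')) β' x) β := by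
    rw [recordGamma_eq, ← hNbar]
    exact mul_le_mul_of_nonneg_left (hfloor.trans hmono) hNbar0.le
  -- assemble
  have hsum : 2 * (Real.exp (-((2 - 2 * Real.cos (2 * Real.pi / L)) / 4 * btLog β ^ 2)) + Real.exp (-(btLog β ^ 2))) * (orthoTransverse L).real Set.univ ≤
      a * (cb * powScale 1 β ^ (6 * Fintype.card (Edge 3 L))) := by
    have hπ0 : 0 ≤ (orthoTransverse L).real Set.univ := measureReal_nonneg
    calc 2 * (Real.exp (-((2 - 2 * Real.cos (2 * Real.pi / L)) / 4 * btLog β ^ 2)) + Real.exp (-(btLog β ^ 2))) * (orthoTransverse L).real Set.univ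
        ≤ 2 * (2 * Real.exp (-((2 - 2 * Real.cos (2 * Real.pi / L)) / 4 * btLog β ^ 2))) * (orthoTransverse L).real Set.univ := by
          refine mul_le_mul_of_nonneg_right (mul_le_mul_of_nonneg_left (by linarith) (by norm_num)) hπ0
      _ = 4 * (orthoTransverse L).real Set.univ * Real.exp (-((2 - 2 * Real.cos (2 * Real.pi / L)) / 4 * btLog β ^ 2)) := by ring
      _ ≤ a * cb * powScale 1 β ^ (6 * Fintype.card (Edge 3 L)) := hb
      _ = a * (cb * powScale 1 β ^ (6 * Fintype.card (Edge 3 L))) := by ring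
  calc fpWeightBar L (powScale 1 β) * (2 * (Real.exp (-((2 - 2 * Real.cos (2 * Real.pi / L)) / 4 * btLog β ^ 2)) + Real.exp (-(btLog β ^ 2)))) *
        (orthoTransverse L).real Set.univ
      = Nbar * (2 * (Real.exp (-((2 - 2 * Real.cos (2 * Real.pi / L)) / 4 * btLog β ^ 2)) + Real.exp (-(btLog β ^ 2))) * (orthoTransverse L).real Set.univ) := by
        rw [hNbar]; ring
    _ ≤ Nbar * (a * (cb * powScale 1 β ^ (6 * Fintype.card (Edge 3 L)))) := mul_le_mul_of_nonneg_left hsum hNbar0.le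
    _ = a * (Nbar * (cb * powScale 1 β ^ (6 * Fintype.card (Edge 3 L)))) := by ring
    _ ≤ _ := mul_le_mul_of_nonneg_left hγ ha.le

end Summit.QuantumFields.YangMills.Theorems.FemtoTransferGap.TwoLattice.ConstTube

end
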